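import Summits.BirchSwinnertonDyer.BirchSwinnertonDyer.Theorems.KimAtThreeDeepUpperWitnessOfZetaBodyStable
import Summits.BirchSwinnertonDyer.BirchSwinnertonDyer.Theorems.KimAtThreeDeepUpperValueRowsGeneral
import Summits.BirchSwinnertonDyer.BirchSwinnertonDyer.Theorems.KimAtThreeDeepUpperAdditiveDefectOfFineKato
import HarnessLib

/-!
# Route `KimAtThreeKolyvagin` (rung W2), crux `DeepUpperAtThreeOffKatoStratum` (item 19562): its NON-ADDITIVE
# rows (good non-anomalous / supersingular / multiplicative reduction at `3`) by the KOLYVAGIN-SYSTEM road —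
# from S24-DEEP ×2 + GZK + Poitou–Tate + a fine Kato package + a certificate supply; NO `(DD)`, NO BSD₃ input

Cell `bsd-addord`, seat `bsd-addord-w2-c3` gen 6; `--supports` stmt-BirchSwinnertonDyer-19076 (parent crux
`DeepUpperAtThree`; its child 19562's registered stub `stub_nonAdditive` is the target shape).  Theorems only
(no definition, no named fact, no instance, no `sorry`); nothing is asserted about any curve; cruxes stay OPEN;
BSD is not proved.  Every displayed hypothesis is quantified over the stub's OWN row binders.

## What, and why

Until now the non-additive rows of crux 19562 (good / multiplicative `3`, `3`-adic tower onto) were reached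
only through Wuthrich 2014 Prop. 21 / the BSD₃ upper half plus the DISPLAYED open statement
(DD) `∂^{(∞)}_{deep}(δ̃) ≤ v₃(∏ c_ℓ)` (Kim 2022 Conj. 1.10 ≤-half; w2-c5 p450990 / p453160, acc1
`…_of_wuthrich_…`).  This file runs the Kolyvagin-system road there instead, exactly as on the additive rows:
seat w2-acc1's reduction-free END `deepUpper_conclusion_of_port_e_deep` (p461725) fed by this seat's
reduction-free deep witness family (`KimAtThreeDeepUpperWitnessOfZetaBodyStable`, THEOREM D-u on `hstab`) whose
value rows are discharged by this seat's `valueRow_of_zetaBody_general` (the `3`-Euler factor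
`E₃(σ₃) = 3⁻¹(3 − a₃σ₃ + 𝟙σ₃²)` of Kato's depleted `L`-value absorbed into the twist).
* `deepWitnessFamily_of_zetaBody_of_valueRows_general` — the deep-keyed family at SOME shift `N₀`, value rows
  DISCHARGED, at ANY reduction type: displayed `hbody`, `hirr`, the functionals with (Λ)-clauses and (ii₂)
  riders at `(j, t, e)`, `hcdA`, and the value certificates in the GENERAL shape (`uκ` integral with
  `uκ·a₃/3`, `uκ·𝟙_{3∤N}/3` integral; COMBINED unit certificate `v₃(uκ·∏_{q∣3A} E_q(1)) = 0`; `R⁻` a unit).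
* `portFamilyDeep_of_fineKato₃_of_certSupply₃` — acc1's displayed port family shape on the rows
  {tower, NOT additive at `3`, NON-ANOMALOUS: `3 ∤ 3 − a₃ + 𝟙_{3∤N}`} ⟸ (C1₃) the FINE KATO PACKAGE AT A
  GOOD / MULTIPLICATIVE `3`: Kato witnesses `(ι, κK, Λ)` of the `ZetaBody` family with `κK` rational of
  `3`-valuation ONE (the coordinate `Λ = 3·exp*_ω`: Kim AJM 148 Lemma 3.4, `exp*_ω(H¹(ℚ₃,T)) =
  (#Ẽ_ns(𝔽₃)·c₃/3^{1+t})ℤ₃`, and Mazur's `3 ∤ c_P` at `9 ∤ N`) and functionals `Λfin j` with the (Λ)-clauses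
  and the two-exponent riders at `(j, t, e)` (true for Kato's witnesses with `(t, e) = (0, v₃(#Ẽ_ns·c₃) − τ)`
  by the crude bound `3·exp*_ω(H¹(K,T)) ⊆ 𝒪_K`, `K/ℚ₃` unramified) — and (C2₃) the CERTIFICATE SUPPLY with the
  depletion certificate `v₃(∏_{q∣3A}(1 − a_q/q + 𝟙_{q∤N}/q)) = −1` (achievable exactly off the anomalous rows:
  the `q = 3` factor is `#Ẽ_ns(𝔽₃)/3`).
* ★ `stub_nonAdditive_nonAnomalous_of_deepFacts_of_fineKato₃_of_certSupply₃` — the registered stub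
  `stub_nonAdditive` of 19562 RESTRICTED to the non-anomalous rows (one extra antecedent), from S24-DEEP ×2,
  GZK, Poitou–Tate, (C1₃), (C2₃).  NO (DD), NO Wuthrich / Kato 14.5(3) / BSD₃ input, NO Manin / period /
  `c₃` / local-torsion hypothesis: off the anomalous good rows the whole of 19562 (hence 19076) carries ONE kind
  of residual object — Kato's fine package at `3` — at every reduction type.
HONEST LIMITS: (C1₃) is construction-shaped (exp*-shaped riders = axioms on bound witnesses); (C2₃) is open
class-wide (per-row decidable; its Kato-stratum twin is a theorem, w2-c3 g4 `unitMinusSymbol_classwide`, whose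
progression argument used `3 ∣ N`); the good ANOMALOUS rows (`3 ∣ 4 − a₃`) are NOT covered (augmentation
`3^{α}·unit`: value exponent `t + α`, a twin of T-PK6-VROW FILE 1 is needed — seat memo).
References: [Kato2004Asterisque] (8.1.3), Prop. 8.12, §9.4, Thm. 9.7, Thm. 6.6 (1), Ex. 13.3;
[Kim2022StructureSelmer] Lemma 3.4, §3.2.3, Thm. 3.13 and its proof, §2.2.2; [Kim2025RefinedTNC] Thm 1.1, §5;
[MazurRubin2004] Thm. 3.2.4, App. A Prop. A.2; [Sakamoto2024] Thm. 4.4; [MilneADT2006] I.4.10; [Mazur1978]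
(Manin constant); acc1 memo W2ACC1-PORTE-19562; this seat's memo W2C3-UNIFORM-PORT-g6.
-/

set_option autoImplicit false
-- the Theorems namespace of a single-conjunct summit repeats the summit name by design (D-0017)
set_option linter.dupNamespace false

noncomputable section

open scoped NumberField TensorProduct ContRepresentation Classical
open CategoryTheory Field Function Finset IsDedekindDomain NumberField WeierstrassCurve
open Rat.HeightOneSpectrum
open Literature.NumberTheory.GaloisRepresentations Literature.NumberTheory.GaloisCohomology
open Literature.NumberTheory.GaloisRepresentations.DiscreteGaloisModule
open Literature.NumberTheory.EllipticCurves Literature.NumberTheory.EllipticCurves.ModularForms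
open Literature.NumberTheory.EllipticCurves.Rank1Residual
open Literature.NumberTheory.EllipticCurves.Kato2004
open Literature.NumberTheory.EllipticCurves.Kato2004.EulerSystemValues
open Summit.BirchSwinnertonDyer.Rank1Residual.GaloisImage
open Summit.BirchSwinnertonDyer.BirchSwinnertonDyer.Theses.KimAtThreeKolyvagin
open Summit.BirchSwinnertonDyer.BirchSwinnertonDyer.Theorems.KimAtThreeDeepUpperWitnessOfZetaBodyStable
open Summit.BirchSwinnertonDyer.BirchSwinnertonDyer.Theorems.KimAtThreeDeepUpperValueRowsGeneral
open Summit.BirchSwinnertonDyer.BirchSwinnertonDyer.Theorems.KimAtThreeDeepUpperAdditiveDefectOfPortEDeep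

namespace Summit.BirchSwinnertonDyer.BirchSwinnertonDyer.Theorems.KimAtThreeDeepUpperNonAdditiveOfFineKato

/-- Local notation: the TWO-EXPONENT rider clause (ii₂) at depth `j`, torsion exponent `t`, defect exponent
`e`, place `v`, for the pair `(Λ, Λf)` — seat acc6's spelling (`KimAtThreeTwoExponentWitnessPair`). -/
local notation3 (prettyPrint := false) "RIDER₂⟦" W' ", " j ", " t' ", " e' ", " v' ", " Λ' ", " Λf "⟧" =>
  ∀ (r : Finset (HeightOneSpectrum (𝓞 ℚ)))
    (Ψ : H1 (tateRep W' 3) (cycSubgroup 3 0 r) →+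
      continuousCohomology 1
        (subgroupRep (WeierstrassCurve.torsionGaloisModule W' (((3 : ℕ) : ℤ) ^ j * ((3 : ℕ) : ℤ))).toTopRep
          (cycSubgroup 3 0 r))),
    (∀ (φ : contOneCocycles (subgroupRep (tateRep W' 3).toTopRep (cycSubgroup 3 0 r)))
        (ψ : contOneCocycles
          (subgroupRep (WeierstrassCurve.torsionGaloisModule W' (((3 : ℕ) : ℤ) ^ j * ((3 : ℕ) : ℤ))).toTopRep
            (cycSubgroup 3 0 r))),
        (∀ g, ((ψ.1 g : geomTorsion W' (((3 : ℕ) : ℤ) ^ j * ((3 : ℕ) : ℤ))) : geomPoints W') =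
          TateModule.proj 3 (j + 1) (φ.1 g)) →
        Ψ (oneCocycleClass _ φ) = oneCocycleClass _ ψ) →
    ∀ (y : H1 (tateRep W' 3) (cycSubgroup 3 0 r))
      (κ₀ : galoisCohomology (WeierstrassCurve.torsionGaloisModule W' (((3 : ℕ) : ℤ) ^ j * ((3 : ℕ) : ℤ))) 1)
      (s : ℤ_[3]),
      resSubgroup (WeierstrassCurve.torsionGaloisModule W' (((3 : ℕ) : ℤ) ^ j * ((3 : ℕ) : ℤ))).toTopRep
          (cycSubgroup 3 0 r) 1 κ₀ = Ψ y →
      galoisCohomology.localization (WeierstrassCurve.torsionGaloisModule W' (((3 : ℕ) : ℤ) ^ j * ((3 : ℕ) : ℤ)))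
          (Sum.inr v') 1 κ₀ ∈ propagatedSelmerStructure W' 3 j (Sum.inr v') →
      (∃ l ∈ cycIntLattice 3 (cycLevel 3 0 r),
          (((3 : ℕ) : ℤ_[3]) ^ t') • Λ' 0 r y - ((s : ℚ_[3]) ⊗ₜ[ℚ] (1 : CyclotomicField (cycLevel 3 0 r) ℚ)) =
            (((3 : ℕ) : ℤ_[3]) ^ (j + 1)) • (l : ℚ_[3] ⊗[ℚ] CyclotomicField (cycLevel 3 0 r) ℚ)) →
      ((3 ^ e' : ℕ) : ZMod (3 ^ (j + 1))) *
        Λf (galoisCohomology.localization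
          (WeierstrassCurve.torsionGaloisModule W' (((3 : ℕ) : ℤ) ^ j * ((3 : ℕ) : ℤ))) (Sum.inr v') 1 κ₀) =
        PadicInt.toZModPow (j + 1) s

/-! ### §1 The deep-keyed witness family with the value rows discharged, any reduction type -/

section Row

variable (W : WeierstrassCurve ℚ) [W.IsElliptic] [W.IsGloballyMinimal]
  [ContinuousSMul ℤ_[3] (W.tateModule 3)] [Module.Free ℤ_[3] (W.tateModule 3)]
  [Module.Finite ℤ_[3] (W.tateModule 3)]

/-- **★★ The deep-keyed witness family at SOME depth shift, value rows DISCHARGED, ANY reduction type at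
`3`** — this seat's `exists_shift_deepWitnessFamily_of_zetaBody` ∘ `valueRow_of_zetaBody_general` at exponent
`t` (`hf := P.isNewformOf`).  Displayed: `hbody`, `hirr`, the functionals with (Λ)-clauses and (ii₂) riders,
`hcdA`, and the GENERAL value certificates `uκ`/`huκ`/`hκ0`/`huκ1`, `d′`/`hcd`/`hdd′`, `hAN`, `aM`/`haM`,
`hκa`/`hκ1` (integrality of `uκ·a₃/3`, `uκ·𝟙_{3∤N}/3`), `hE0`, the combined certificate `hκE`, `hR0`/`hR`.
NO reduction-type, `ht0`, bad-place, Manin or period hypothesis.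
[cite: Kato2004Asterisque, (8.1.3) (p. 180), §9.4 (p. 188), Thm. 9.7 (p. 189), Thm. 6.6 (1) (p. 163) and Ex. 13.3 (pp. 224–225)]
[cite: Kim2022StructureSelmer, Thm. 3.13, Lemma 3.4 and §2.2.2] [cite: MazurRubin2004, App. A Prop. A.2 and Thm. 3.2.4] -/
theorem deepWitnessFamily_of_zetaBody_of_valueRows_general
    {N : ℕ} [NeZero N] (P : ModularParametrizationData W N) (hN : N = W.conductorNorm ℤ)
    {ι : (n : ℕ) → (CyclotomicField n ℚ →+* ℂ)} {κK : ℝ}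
    {Λ : ∀ (k' : ℕ) (r : Finset (HeightOneSpectrum (𝓞 ℚ))),
      H1 (tateRep W 3) (cycSubgroup 3 k' r) →ₗ[ℤ_[3]] ℚ_[3] ⊗[ℚ] CyclotomicField (cycLevel 3 k' r) ℚ}
    {c d a : ℤ} {A : ℕ} [NeZero A]
    {z : ∀ (k' : ℕ) (r : (cyclotomicLevelsRat 3 (badPlaces c d A N)).Ideals),
      H1 (tateRep W 3) ((cyclotomicLevelsRat 3 (badPlaces c d A N)).level k' r.1)}
    {x : ∀ (k' : ℕ) (r : (cyclotomicLevelsRat 3 (badPlaces c d A N)).Ideals),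
      CyclotomicField (cycLevel 3 k' r.1) ℚ}
    (hbody : ZetaBody W 3 P.f ι κK Λ c d a A z x)
    (hirr : W.HasIrreducibleModPGaloisRep 3)
    {t e : ℕ} {v₃ : HeightOneSpectrum (𝓞 ℚ)} (hv₃ : ((3 : ℕ) : 𝓞 ℚ) ∈ v₃.asIdeal)
    (Λfin : ∀ j : ℕ, galoisCohomology ((W.torsionGaloisModule (((3 : ℕ) : ℤ) ^ j * ((3 : ℕ) : ℤ))).toLocal
      (Sum.inr v₃)) 1 →+ ZMod (3 ^ (j + 1)))
    (hΛ : ∀ j : ℕ,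
      (∀ c : ZMod (3 ^ (j + 1)), ∃ x ∈ propagatedSelmerStructure W 3 j (Sum.inr v₃), Λfin j x = c) ∧
      (∀ x ∈ propagatedSelmerStructure W 3 j (Sum.inr v₃),
        Λfin j x = 0 ↔ x ∈ W.kummerSelmerStructure (((3 : ℕ) : ℤ) ^ j * ((3 : ℕ) : ℤ)) (Sum.inr v₃)))
    (hfin₂ : ∀ j : ℕ, RIDER₂⟦W, j, t, e, v₃, Λ, Λfin j⟧)
    {η : (q : HeightOneSpectrum (𝓞 ℚ)) → (ZMod (Ideal.absNorm q.asIdeal))ˣ}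
    (hcdA : ∀ q : ℕ, q.Prime → q ≡ 1 [MOD 3] → ¬ q ∣ 2 * c.natAbs * d.natAbs * A)
    -- the VALUE certificates, GENERAL shape (this seat's `valueRow_of_zetaBody_general`), level-free
    (uκ : ℚ) (huκ : (uκ : ℝ) = κK) (hκ0 : κK ≠ 0) (huκ1 : ‖(uκ : ℚ_[3])‖ ≤ 1)
    (d' : ℤ) (hcd : Int.gcd (c * d) A = 1) (hdd' : d * d' ≡ 1 [ZMOD (A : ℤ)])
    (hAN : Nat.Coprime A N)
    (aM : ℕ → ℤ) (haM : ∀ q ∈ (3 * A).primeFactors, cuspCoeff P.f q = aM q)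
    (hκa : ‖((uκ * ((aM 3 : ℚ) / (3 : ℕ)) : ℚ) : ℚ_[3])‖ ≤ 1)
    (hκ1 : ‖((uκ * (if 3 ∣ N then 0 else (1 / (3 : ℕ) : ℚ)) : ℚ) : ℚ_[3])‖ ≤ 1)
    (hE0 : ∏ q ∈ (3 * A).primeFactors, (1 - (aM q : ℚ) / q + (if q ∣ N then 0 else (1 / q : ℚ))) ≠ 0)
    (hκE : padicValRat 3
      (uκ * ∏ q ∈ (3 * A).primeFactors, (1 - (aM q : ℚ) / q + (if q ∣ N then 0 else (1 / q : ℚ)))) = 0)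
    (hR0 : (c : ℚ) ^ 2 * (d : ℚ) ^ 2 * ratMinusSymbol P.f ((a : ℚ) / A) -
        (c : ℚ) * (d : ℚ) ^ 2 * ratMinusSymbol P.f ((a * c : ℚ) / A) -
        (c : ℚ) ^ 2 * (d : ℚ) * ratMinusSymbol P.f ((a * d' : ℚ) / A) +
        (c : ℚ) * (d : ℚ) * ratMinusSymbol P.f ((a * c * d' : ℚ) / A) ≠ 0)
    (hR : padicValRat 3 ((c : ℚ) ^ 2 * (d : ℚ) ^ 2 * ratMinusSymbol P.f ((a : ℚ) / A) -
        (c : ℚ) * (d : ℚ) ^ 2 * ratMinusSymbol P.f ((a * c : ℚ) / A) -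
        (c : ℚ) ^ 2 * (d : ℚ) * ratMinusSymbol P.f ((a * d' : ℚ) / A) +
        (c : ℚ) * (d : ℚ) * ratMinusSymbol P.f ((a * c * d' : ℚ) / A)) = 0) :
    ∃ N₀ : ℕ, ∀ (k : ℕ) (Dk : KolyvaginDatum (W.torsionGaloisModule (((3 : ℕ) : ℤ) ^ k * ((3 : ℕ) : ℤ)))),
      Dk.IsCanonicalTauDatumThreeAtWith W (k + N₀) k η →
      ∃ (κ : Finset (HeightOneSpectrum (𝓞 ℚ)) →
            galoisCohomology (W.torsionGaloisModule (((3 : ℕ) : ℤ) ^ k * ((3 : ℕ) : ℤ))) 1)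
        (Λ' : galoisCohomology ((W.torsionGaloisModule (((3 : ℕ) : ℤ) ^ k * ((3 : ℕ) : ℤ))).toLocal
            (Sum.inr v₃)) 1 →+ ZMod (3 ^ (k + 1)))
        (κ' : Finset (HeightOneSpectrum (𝓞 ℚ)) →
            galoisCohomology (W.torsionGaloisModule (((3 : ℕ) : ℤ) ^ k * ((3 : ℕ) : ℤ))) 1),
        KatoKuriharaWitnessAt W k t Dk v₃ P κ Λ' κ' :=
  exists_shift_deepWitnessFamily_of_zetaBody W P hN hbody hirr hv₃ Λfin hΛ hfin₂ hcdA
    fun j σ hσI hσχ r hr hKol hη => valueRow_of_zetaBody_general hbody P.isNewformOf (by decide) hirr uκ huκ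
      hκ0 huκ1 d' hcd hdd' hAN aM haM hκa hκ1 hE0 hκE hR0 hR η j t σ hσI hσχ r hr hKol hη

end Row

/-! ### §2 The non-additive, non-anomalous rows of 19562: acc1's port family from (C1₃) + (C2₃) -/

section NonAdditive

variable
  -- (C1₃) FINE KATO PACKAGE AT A GOOD / MULTIPLICATIVE `3`, coordinate `Λ = 3·exp*_ω` (`v₃(κK) = 1`), with the
  -- rider clause (ii₂) at the row's exponents `(t, e)` — crux 19560's (C1) shape off the additive locus
  (hC1 : ∀ (W : WeierstrassCurve ℚ) [W.IsElliptic] [W.IsGloballyMinimal]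
    [ContinuousSMul ℤ_[3] (W.tateModule 3)] [Module.Free ℤ_[3] (W.tateModule 3)]
    [Module.Finite ℤ_[3] (W.tateModule 3)],
    (∀ m : ℕ, W.HasSurjectiveModNGaloisRep (3 ^ m : ℕ)) →
    ¬ (haveI : Fact (Nat.Prime 3) := ⟨Nat.prime_three⟩; Addv W 3) →
    ∀ (v₃ : HeightOneSpectrum (𝓞 ℚ)), ((3 : ℕ) : 𝓞 ℚ) ∈ v₃.asIdeal →
    ∀ {N : ℕ} [NeZero N] (P : ModularParametrizationData W N), N = W.conductorNorm ℤ →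
      (∀ z ∈ P.L.lattice, ∃ w ∈ periodLattice P.f, z = P.c * w) →
      ¬ (3 : ℤ) ∣ 3 - W.LFunction 3 + (if 3 ∣ N then 0 else 1) →
      ∃ (t e : ℕ) (ι : (n : ℕ) → (CyclotomicField n ℚ →+* ℂ)) (κK : ℝ)
        (Λ : ∀ (k' : ℕ) (r : Finset (HeightOneSpectrum (𝓞 ℚ))),
          H1 (tateRep W 3) (cycSubgroup 3 k' r) →ₗ[ℤ_[3]] ℚ_[3] ⊗[ℚ] CyclotomicField (cycLevel 3 k' r) ℚ)
        (Λfin : ∀ j : ℕ, galoisCohomology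
          ((W.torsionGaloisModule (((3 : ℕ) : ℤ) ^ j * ((3 : ℕ) : ℤ))).toLocal (Sum.inr v₃)) 1 →+
            ZMod (3 ^ (j + 1))),
        κK ≠ 0 ∧ (∃ u : ℚ, (u : ℝ) = κK ∧ padicValRat 3 u = 1) ∧
        (∀ j : ℕ,
          (∀ c : ZMod (3 ^ (j + 1)), ∃ x ∈ propagatedSelmerStructure W 3 j (Sum.inr v₃), Λfin j x = c) ∧
          (∀ x ∈ propagatedSelmerStructure W 3 j (Sum.inr v₃),
            Λfin j x = 0 ↔ x ∈ W.kummerSelmerStructure (((3 : ℕ) : ℤ) ^ j * ((3 : ℕ) : ℤ)) (Sum.inr v₃))) ∧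
        (∀ j : ℕ, RIDER₂⟦W, j, t, e, v₃, Λ, Λfin j⟧) ∧
        ∀ (c d a : ℤ) (A : ℕ), 0 < A → Int.gcd c (6 * 3 * A) = 1 → Int.gcd d (6 * 3 * N) = 1 →
          ∃ (z : ∀ (k' : ℕ) (r : (cyclotomicLevelsRat 3 (badPlaces c d A N)).Ideals),
                H1 (tateRep W 3) ((cyclotomicLevelsRat 3 (badPlaces c d A N)).level k' r.1))
            (x : ∀ (k' : ℕ) (r : (cyclotomicLevelsRat 3 (badPlaces c d A N)).Ideals),
                CyclotomicField (cycLevel 3 k' r.1) ℚ),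
            ZetaBody W 3 P.f ι κK Λ c d a A z x)
  -- (C2₃) CERTIFICATE SUPPLY off the additive locus: Kato's auxiliary datum with the usual guards, the cusp
  -- certificate `v₃(R⁻) = 0` and the depletion certificate `v₃(∏_{q∣3A} E_q(1)) = −1` (its `q = 3` factor is
  -- `#Ẽ_ns(𝔽₃)/3`: achievable exactly on the non-anomalous rows)
  (hC2 : ∀ (W : WeierstrassCurve ℚ) [W.IsElliptic] [W.IsGloballyMinimal],
    (∀ m : ℕ, W.HasSurjectiveModNGaloisRep (3 ^ m : ℕ)) →
    ¬ (haveI : Fact (Nat.Prime 3) := ⟨Nat.prime_three⟩; Addv W 3) →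
    ∀ {N : ℕ} [NeZero N] (P : ModularParametrizationData W N), N = W.conductorNorm ℤ →
      (∀ z ∈ P.L.lattice, ∃ w ∈ periodLattice P.f, z = P.c * w) →
      ¬ (3 : ℤ) ∣ 3 - W.LFunction 3 + (if 3 ∣ N then 0 else 1) →
      ∃ (c d a : ℤ) (A : ℕ) (d' : ℤ) (aM : ℕ → ℤ),
        0 < A ∧ Int.gcd c (6 * 3 * A) = 1 ∧ Int.gcd d (6 * 3 * N) = 1 ∧
        (∀ q : ℕ, q.Prime → q ≡ 1 [MOD 3] → ¬ q ∣ 2 * c.natAbs * d.natAbs * A) ∧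
        Int.gcd (c * d) A = 1 ∧ d * d' ≡ 1 [ZMOD (A : ℤ)] ∧ Nat.Coprime A N ∧
        (∀ q ∈ (3 * A).primeFactors, cuspCoeff P.f q = aM q) ∧
        (∏ q ∈ (3 * A).primeFactors,
            (1 - (aM q : ℚ) / q + (if q ∣ N then 0 else (1 / q : ℚ))) ≠ 0) ∧
        padicValRat 3 (∏ q ∈ (3 * A).primeFactors,
            (1 - (aM q : ℚ) / q + (if q ∣ N then 0 else (1 / q : ℚ)))) = -1 ∧
        ((c : ℚ) ^ 2 * (d : ℚ) ^ 2 * ratMinusSymbol P.f ((a : ℚ) / A) -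
            (c : ℚ) * (d : ℚ) ^ 2 * ratMinusSymbol P.f ((a * c : ℚ) / A) -
            (c : ℚ) ^ 2 * (d : ℚ) * ratMinusSymbol P.f ((a * d' : ℚ) / A) +
            (c : ℚ) * (d : ℚ) * ratMinusSymbol P.f ((a * c * d' : ℚ) / A) ≠ 0) ∧
        padicValRat 3 ((c : ℚ) ^ 2 * (d : ℚ) ^ 2 * ratMinusSymbol P.f ((a : ℚ) / A) -
            (c : ℚ) * (d : ℚ) ^ 2 * ratMinusSymbol P.f ((a * c : ℚ) / A) -
            (c : ℚ) ^ 2 * (d : ℚ) * ratMinusSymbol P.f ((a * d' : ℚ) / A) +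
            (c : ℚ) * (d : ℚ) * ratMinusSymbol P.f ((a * c * d' : ℚ) / A)) = 0)

include hC1 hC2

/-- **acc1's displayed port family on the non-additive, non-anomalous rows of 19562, from (C1₃) + (C2₃)** —
per row: (C2₃) gives Kato's auxiliary datum with its certificates, (C1₃) gives `(t, e, ι, κK, Λ, Λfin)` and
`ZetaBody` for that datum, `v₃(κK) = 1` makes `uκ·a₃/3`, `uκ·𝟙/3` integral and — with the depletion certificate
`−1` — the combined certificate `0`; then §1 (shift `N₀` of the row, exponent `t`).  Instance binders of the
Tate module are discharged by the tree's `_holds` theorems; `E[3]` is irreducible under the tower.  Closes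
nothing; (C1₃)/(C2₃) stay displayed.
[cite: Kato2004Asterisque, (8.1.3) (p. 180), §9.4 (p. 188), Thm. 9.7 (p. 189) and Ex. 13.3 (pp. 224–225)]
[cite: Kim2022StructureSelmer, Thm. 3.13, Lemma 3.4 and §2.2.2] [cite: MazurRubin2004, App. A Prop. A.2] -/
theorem portFamilyDeep_of_fineKato₃_of_certSupply₃ :
    ∀ (W : WeierstrassCurve ℚ) [W.IsElliptic] [W.IsGloballyMinimal],
      (∀ m : ℕ, W.HasSurjectiveModNGaloisRep (3 ^ m : ℕ)) →
      ¬ (haveI : Fact (Nat.Prime 3) := ⟨Nat.prime_three⟩; Addv W 3) →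
      ∀ (v₃ : HeightOneSpectrum (𝓞 ℚ)), ((3 : ℕ) : 𝓞 ℚ) ∈ v₃.asIdeal →
      ∀ (η : (q : HeightOneSpectrum (𝓞 ℚ)) → (ZMod (Ideal.absNorm q.asIdeal))ˣ),
        (∀ q, Subgroup.zpowers (η q) = ⊤) →
      ∀ {N : ℕ} [NeZero N] (P : ModularParametrizationData W N), N = W.conductorNorm ℤ →
        (∀ z ∈ P.L.lattice, ∃ w ∈ periodLattice P.f, z = P.c * w) →
        ¬ (3 : ℤ) ∣ 3 - W.LFunction 3 + (if 3 ∣ N then 0 else 1) →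
        ∃ t e : ℕ, ∀ (k : ℕ)
          (Dk : KolyvaginDatum (W.torsionGaloisModule (((3 : ℕ) : ℤ) ^ k * ((3 : ℕ) : ℤ)))),
          Dk.IsCanonicalTauDatumThreeAtWith W (k + t) k η →
          ∃ (κ : Finset (HeightOneSpectrum (𝓞 ℚ)) →
                galoisCohomology (W.torsionGaloisModule (((3 : ℕ) : ℤ) ^ k * ((3 : ℕ) : ℤ))) 1)
            (Λ : galoisCohomology ((W.torsionGaloisModule (((3 : ℕ) : ℤ) ^ k * ((3 : ℕ) : ℤ))).toLocal
                (Sum.inr v₃)) 1 →+ ZMod (3 ^ (k + 1)))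
            (κ' : Finset (HeightOneSpectrum (𝓞 ℚ)) →
                galoisCohomology (W.torsionGaloisModule (((3 : ℕ) : ℤ) ^ k * ((3 : ℕ) : ℤ))) 1),
            KatoKuriharaWitnessAt W k e Dk v₃ P κ Λ κ' := by
  intro W _ _ htow hA v₃ hv₃ η _hη N _ P hN hlat hna
  haveI : Fact (Nat.Prime 3) := ⟨Nat.prime_three⟩
  haveI : ContinuousSMul ℤ_[3] (W.tateModule 3) := TateModule.continuousSMul_padicInt
  haveI : Module.Free ℤ_[3] (W.tateModule 3) := W.module_free_tateModule_holds 3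
  haveI : Module.Finite ℤ_[3] (W.tateModule 3) := W.module_finite_tateModule_holds 3
  obtain ⟨c, d, a, A, d', aM, hApos, hcA, hdN, hcdA, hcd, hdd', hAN, haM, hE0, hE, hR0, hR⟩ :=
    hC2 W htow hA P hN hlat hna
  haveI : NeZero A := ⟨hApos.ne'⟩
  obtain ⟨t, e, ι, κK, Λ, Λfin, hκ0, ⟨uκ, huκ, hvu⟩, hΛ, hfin₂, hz⟩ := hC1 W htow hA v₃ hv₃ P hN hlat hna
  obtain ⟨z, x, hbody⟩ := hz c d a A hApos hcA hdN
  have hirr : W.HasIrreducibleModPGaloisRep 3 :=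
    KimAtThreeKolyvaginPortShared.hasIrreducibleModPGaloisRep_three_of_tower W htow
  -- `v₃(uκ) = 1`: `uκ`, `uκ·a₃/3`, `uκ·𝟙/3` are `3`-integral and the combined certificate is `0`
  have huκ0 : uκ ≠ 0 := by rintro rfl; exact hκ0 (by rw [← huκ, Rat.cast_zero])
  have hnorm3 : ‖(uκ : ℚ_[3])‖ = 3⁻¹ := by
    rw [Padic.norm_eq_zpow_neg_valuation (by exact_mod_cast huκ0), Padic.valuation_ratCast, hvu]
    norm_num
  have huκ1 : ‖(uκ : ℚ_[3])‖ ≤ 1 := by rw [hnorm3]; norm_num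
  have hthird : ∀ m : ℤ, ‖((uκ * ((m : ℚ) / (3 : ℕ)) : ℚ) : ℚ_[3])‖ ≤ 1 := by
    intro m
    rw [Rat.cast_mul, norm_mul, hnorm3, Rat.cast_div, norm_div, Rat.cast_intCast, Rat.cast_natCast,
      Nat.cast_ofNat]
    have h3 : ‖(3 : ℚ_[3])‖ = 3⁻¹ := by
      have := Padic.norm_p (p := 3)
      simpa using this
    rw [h3]
    have hm : ‖((m : ℤ) : ℚ_[3])‖ ≤ 1 := Padic.norm_int_le_one m
    have : ‖((m : ℤ) : ℚ_[3])‖ / 3⁻¹ = 3 * ‖((m : ℤ) : ℚ_[3])‖ := by field_simp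
    rw [this]
    nlinarith [norm_nonneg ((m : ℤ) : ℚ_[3])]
  have hκa : ‖((uκ * ((aM 3 : ℚ) / (3 : ℕ)) : ℚ) : ℚ_[3])‖ ≤ 1 := hthird (aM 3)
  have hκ1 : ‖((uκ * (if 3 ∣ N then 0 else (1 / (3 : ℕ) : ℚ)) : ℚ) : ℚ_[3])‖ ≤ 1 := by
    by_cases h3N : 3 ∣ N
    · rw [if_pos h3N, mul_zero, Rat.cast_zero, norm_zero]; exact zero_le_one
    · rw [if_neg h3N]
      have h := hthird 1
      rw [Int.cast_one] at h
      exact h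
  have hκE : padicValRat 3
      (uκ * ∏ q ∈ (3 * A).primeFactors, (1 - (aM q : ℚ) / q + (if q ∣ N then 0 else (1 / q : ℚ)))) = 0 := by
    rw [padicValRat.mul huκ0 hE0, hvu, hE]; norm_num
  obtain ⟨N₀, hfam⟩ := deepWitnessFamily_of_zetaBody_of_valueRows_general W P hN hbody hirr hv₃ Λfin hΛ
    hfin₂ hcdA uκ huκ hκ0 huκ1 d' hcd hdd' hAN aM haM hκa hκ1 hE0 hκE hR0 hR
  exact ⟨N₀, t, hfam⟩

/-- ★ **The registered stub `stub_nonAdditive` of crux 19562, RESTRICTED to the NON-ANOMALOUS rows (one extra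
antecedent `¬ 3 ∣ 3 − a₃(W) + 𝟙_{3∤N}`), from S24-DEEP ×2, GZK, Poitou–Tate, (C1₃) and (C2₃)** — acc1's
reduction-free END (`deepUpper_datum_of_poitouTate_of_port_e_deep`) fed §2's port family.  NO (DD), NO
Wuthrich / BSD₃ input, NO `ht0`, NO bad-place certificate, NO Manin / period / `c₃` hypothesis: the
non-additive non-anomalous rows of 19562 carry crux 19560's KIND of residual object (a fine Kato package at `3`
and a certificate supply) and nothing else.  Multiplicative rows are never anomalous (`3 − a₃ ∈ {2, 4}`), so
only the good rows with `3 ∣ 4 − a₃` are outside.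
[cite: Kim2025RefinedTNC, Thm 1.1] [cite: Kim2022StructureSelmer, Thm. 3.13, Lemma 3.4 and §2.2.2]
[cite: Sakamoto2024, Thm. 4.4 (1)(2) (p. 926)] [cite: MilneADT2006, Ch. I, Thm. 4.10]
[cite: Kato2004Asterisque, (8.1.3), §9.4, Thm. 9.7 and Ex. 13.3] -/
theorem stub_nonAdditive_nonAnomalous_of_deepFacts_of_fineKato₃_of_certSupply₃
    (hS24d : S24Deep.kolyvaginSystems_freeRankOne_zmod_three_pow_deep)
    (hS24d₂ : S24Deep.kolyvaginSystems_idealOfBasis_eq_fittingIdeal_zmod_three_pow_deep)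
    (hGZK : rank_eq_analyticRank_of_analyticRank_le_one)
    (hPT : poitouTate_selmerStructure_duality ℚ) :
    ∀ (W₀ : WeierstrassCurve ℚ) [W₀.IsElliptic] [W₀.IsGloballyMinimal],
      (∀ n : ℕ, W₀.HasSurjectiveModNGaloisRep (3 ^ n : ℕ)) → Finite W₀.sha →
      ∀ {N : ℕ} [NeZero N], N = W₀.conductorNorm ℤ →
      ∀ (D₀ : Literature.NumberTheory.EllipticCurves.ModularForms.ModularParametrizationData W₀ N),
        (∀ z ∈ D₀.L.lattice, ∃ w ∈ Literature.NumberTheory.EllipticCurves.ModularForms.periodLattice D₀.f, z = D₀.c * w) →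
        (∀ (W₂ : WeierstrassCurve ℚ) [W₂.IsElliptic]
          (D₂ : Literature.NumberTheory.EllipticCurves.ModularForms.ModularParametrizationData W₂ N),
          D₂.f = D₀.f → D₀.modularDegree ≤ D₂.modularDegree) →
        (∀ r : ℚ, Literature.NumberTheory.EllipticCurves.ratPlusSymbol D₀.f r ≠ 0 →
          0 ≤ padicValRat 3 (Literature.NumberTheory.EllipticCurves.ratPlusSymbol D₀.f r)) →
        Literature.NumberTheory.EllipticCurves.kuriharaVanishingOrder W₀ 3 D₀.f = 0 →
        ¬ (haveI : Fact (Nat.Prime 3) := ⟨Nat.prime_three⟩;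
            Literature.NumberTheory.EllipticCurves.Rank1Residual.Addv W₀ 3) →
        ¬ (3 : ℤ) ∣ 3 - W₀.LFunction 3 + (if 3 ∣ N then 0 else 1) →
        ∃ d : ℕ, Literature.NumberTheory.EllipticCurves.kuriharaPartialDeepInfty W₀ 3 D₀.f = d ∧
          ((padicValNat 3 (Nat.card (AddCommGroup.primaryComponent W₀.sha 3)) + d : ℕ) : ℕ∞) ≤
            Literature.NumberTheory.EllipticCurves.kuriharaPartial W₀ 3 D₀.f 0 := by
  intro W₀ _ _ htow _ N _ hN D₀ hopt _ hint hord hA hna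
  obtain ⟨v₃, η, hv₃, hη⟩ := KimAtThreeShallowEqDeepSplitGlueNoStub.exists_place_three_and_generators
  obtain ⟨t, e, hPort⟩ := portFamilyDeep_of_fineKato₃_of_certSupply₃ hC1 hC2 W₀ htow hA v₃ hv₃ η hη D₀ hN
    hopt hna
  exact deepUpper_datum_of_poitouTate_of_port_e_deep hS24d hS24d₂ hGZK hPT W₀ htow D₀ hint hord v₃ hv₃ η
    hη t e hPort

end NonAdditive

end Summit.BirchSwinnertonDyer.BirchSwinnertonDyer.Theorems.KimAtThreeDeepUpperNonAdditiveOfFineKato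

end
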